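import Literature.AlgebraicGeometry.AbelianSchemes.AbelianSchemeSpread
import Literature.AlgebraicGeometry.AbelianSchemes.AbelianSchemeMorphismSpread
import Literature.AlgebraicGeometry.AbelianSchemes.AbelianSchemeCotangentCharpolySpread
import Literature.AlgebraicGeometry.Motives.JacobianGeneratesDimensionBound
import Literature.AlgebraicGeometry.Motives.GroupObjectSumMaps
import Literature.AlgebraicGeometry.Motives.JacobianBaseChangeSurjective
import Literature.AlgebraicGeometry.Motives.JacobianOfIso
import Literature.AlgebraicGeometry.Motives.AbelianVarietyBaseChangeTower
import Literature.AlgebraicGeometry.AbelianSchemes.AbelianSchemeGeneratesSpread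
import Literature.FieldTheory.Galois.FiniteTypeGaloisLevel
import HarnessLib

/-!
# The Albanese dimension is invariant under base change to `ℂ`: `dim J(X_ℂ) = dim J(X)` for `X / k ⊆ ℂ`

Topic `Literature/AlgebraicGeometry/Motives`; namespace `Literature.AlgebraicGeometry.Motives`.  Cell `hodgecm-mathlib` (D-0151),
row III-0, road of record `A-provers/A-p14/ROAD-III0-albanese-baseChange.md` — piece F5 = THE ASSEMBLY of F0 (`exists_jacobian_nonempty_iso_baseChange`),
F1 (`GroupObjectSumMaps`), F2 (`AbelianSchemeSpread`), F3 (`AbelianSchemeMorphismSpread`), F4 (`Limits/SurjectiveSpread`),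
B-p16's `AbelianSchemeGeneratesSpread`, A-p17's `JacobianGeneratesDimensionBound` / `FieldTheory/Galois/FiniteTypeGaloisLevel`.
THEOREMS ONLY (no definition, no named fact, no instance; debt 0).

THE STATEMENT.  For a smooth projective geometrically irreducible `X` over a subfield `k ⊆ ℂ` (`[Algebra k ℂ]`), every
Albanese datum `𝒥 : Jacobian X` over `k` (the tree's point-free Albanese variety, `Motives/Jacobian`) and every
`𝒥' : Jacobian (X_ℂ)`: **`dim J(X_ℂ) = dim J(X)`** (`Jacobian.dim_baseChange_complex_eq`; `≤` is the content,
`Jacobian.dim_le_dim_of_baseChange_complex`; `≥` is the surjective comparison map of `JacobianBaseChangeSurjective`).  This is the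
dimension half of «formation of the Albanese variety commutes with extension of the base field» [FGA VI Thm. 3.3 (iii)] in
characteristic `0` over subfields of `ℂ`, proved WITHOUT Picard schemes or duality: spread the complex Albanese and its pointed
Abel–Jacobi map over a finitely generated `k`-subalgebra of `ℂ`, transport generation to a finite Galois level, and compare
dimensions there by the universal property and Galois descent (module docstrings of the pieces for the individual steps).
Consequence for Liu 2021 Lemma 2.4 (1) (row III-0): `finrank_bettiCohomology_le_two_mul_dim_of_baseChange_complex` — the complex
Albanese inequality `b₁(X_ℂ) ≤ 2 dim J(X_ℂ)` implies `b₁(X_ℂ) ≤ 2 dim J(X)`, the hypothesis of the tree's Albanese criterion for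
the base-changed Abel–Jacobi map.  HC_CM is proved only modulo the 7 printed citations until rung 0 closes; nothing here
discharges a binder by itself.

## References
* [Grothendieck1962FGA6] A. Grothendieck, FGA VI (Sém. Bourbaki 236, 1962), Thm. 3.3 (iii).
* [Badescu2001] L. Bădescu, *Algebraic Surfaces* (2001), Ch. 5 Def. 5.2, Thm. 5.3.
* [Serre1958MorphismesUniversels] J.-P. Serre, *Morphismes universels et variété d'Albanese*, Sém. Chevalley 4 (1958/59), exp. 10, no. 1–2.
* [Milne1986JacobianVarieties] J. S. Milne, *Jacobian Varieties* (1986), §2, §6 Prop. 6.1, 6.4, Remark 1.9.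
* [Liu2021] Y. Liu, *Fourier–Jacobi cycles and arithmetic relative trace formula*, Camb. J. Math. 9 (2021), Lemma 2.4 (1).
-/

set_option autoImplicit false

noncomputable section

open CategoryTheory CategoryTheory.Limits AlgebraicGeometry MonoidalCategory CartesianMonoidalCategory

namespace Literature.AlgebraicGeometry.Motives

open Literature.AlgebraicGeometry.AbelianSchemes Literature.AlgebraicGeometry.AbelianSchemes.AbelianScheme
open Literature.AlgebraicGeometry.Limits
open AbelianVariety (bcSpec bcFunctor)
open scoped MonObj Obj

set_option backward.isDefEq.respectTransparency false

universe u

/-! ## §1 Generation is insensitive to isomorphisms of the target abelian variety -/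

section GeneratesIso

variable {K : Type u} [Field K] {X : SchemeOver K} {A B : AbelianVariety K}

/-- A generating morphism followed by an ISOMORPHISM of abelian varieties still generates (the sum maps are composed with the
isomorphism, `pmSum_comp`). [cite: Serre1958MorphismesUniversels, no. 1] -/
theorem Generates.comp_iso {φ : X ⟶ A.X} (hφ : Generates φ) (u : A ≅ B) : Generates (φ ≫ u.hom.hom.hom.hom) := by
  obtain ⟨n, hn⟩ := hφ
  refine ⟨n, ?_⟩
  rw [pmSum_comp φ u.hom n, Over.comp_left]
  haveI : IsIso (AbelianVariety.Hom.toSchemeHom u.hom) :=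
    ⟨AbelianVariety.Hom.toSchemeHom u.inv, by rw [← AbelianVariety.toSchemeHom_comp, u.hom_inv_id]; rfl,
      by rw [← AbelianVariety.toSchemeHom_comp, u.inv_hom_id]; rfl⟩
  change Surjective ((pmSum φ n).left ≫ AbelianVariety.Hom.toSchemeHom u.hom)
  infer_instance

end GeneratesIso

/-! ## §2 A point of `X_K` over a rational point of `X`, and the pointed Abel–Jacobi map over `K` -/

section Point

variable {k : Type u} [Field k] {K : Type u} [Field K] [Algebra k K] {X : SchemeOver k}

/-- **A `K`-point of `X_K` over a rational point `P₀ ∈ X(k)`**: there is `Q ∈ X_K(K)` through which the base-changed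
point `(P₀)_K : (𝟙_k)_K → X_K` factors as «constant map at `Q`» — namely `Spec K → (𝟙_k)_K → X_K` through the unit
isomorphism of the monoidal base-change functor; the factorisation holds because `(𝟙_k)_K ≅ 𝟙_K` is terminal.  Theorems only:
the point is produced existentially (base change of rational points, Görtz–Wedhorn I (4.7)). [cite: GortzWedhorn2020, Section (4.7)] -/
theorem exists_algPoints_baseChange_of_algPoints (P₀ : AlgPoints X k) :
    ∃ Q : AlgPoints ((bcFunctor k K).obj X) K,
      (bcFunctor k K).map P₀.toUnitHom ≫ toSpecOver _ ≫ Q = (bcFunctor k K).map P₀.toUnitHom := by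
  have ht : IsTerminal ((bcFunctor k K).obj (𝟙_ (SchemeOver k))) :=
    IsTerminal.ofIso isTerminalTensorUnit (Functor.Monoidal.εIso (bcFunctor k K))
  refine ⟨(toUnit _ ≫ Functor.LaxMonoidal.ε (bcFunctor k K)) ≫ (bcFunctor k K).map P₀.toUnitHom, ?_⟩
  rw [← Category.assoc, ← Category.assoc,
    ht.hom_ext (((bcFunctor k K).map P₀.toUnitHom ≫ toSpecOver _) ≫ _) (𝟙 _), Category.id_comp]

/-- **The Abel–Jacobi map at such a point kills the base-changed rational point**: if `(P₀)_K` factors through `Q` as above,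
`(P₀)_K ≫ f^Q = 1` for every Jacobian `𝒥'` of `X_K` (`f^Q(x) = [x − Q]` and `[Q − Q] = 0`). [cite: Milne1986JacobianVarieties, §2] -/
theorem map_toUnitHom_comp_abelJacobi_eq_one (𝒥' : Jacobian ((bcFunctor k K).obj X)) (P₀ : AlgPoints X k)
    (Q : AlgPoints ((bcFunctor k K).obj X) K)
    (hQ : (bcFunctor k K).map P₀.toUnitHom ≫ toSpecOver _ ≫ Q = (bcFunctor k K).map P₀.toUnitHom) :
    (bcFunctor k K).map P₀.toUnitHom ≫ 𝒥'.abelJacobi Q = 1 := by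
  rw [Jacobian.abelJacobi, comp_lift_assoc, Category.comp_id, hQ,
    show lift ((bcFunctor k K).map P₀.toUnitHom) ((bcFunctor k K).map P₀.toUnitHom) =
      (bcFunctor k K).map P₀.toUnitHom ≫ lift (𝟙 _) (𝟙 _) by simp, Category.assoc, 𝒥'.diag_diff, MonObj.comp_one]

end Point

/-! ## §3 The dimension inequality -/

section Main

variable {k : Type} [Field k] [Algebra k ℂ] {d : ℕ} {X : SchemeOver k}

/-- **The Albanese dimension does not grow under base change to `ℂ` (pointed case).**  For `X` smooth projective
geometrically irreducible over a subfield `k ⊆ ℂ` with a rational point `P₀`, ANY Jacobian (= Albanese datum) `𝒥` of `X` over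
`k` and ANY Jacobian `𝒥'` of `X_ℂ` over `ℂ`: `dim J(X_ℂ) ≤ dim J(X)`.  Proof (the road of record, no Picard scheme, no duality):
spread `J' = J(X_ℂ)` to an abelian scheme `𝒜` over a finitely generated `k`-subalgebra `T ⊆ ℂ` (`exists_abelianScheme_relDim_fibre_iso`),
spread the pointed generating Abel–Jacobi map `X_ℂ → J' ≅ 𝒜_ψ` to a stage `T ⊆ R ⊆ ℂ` (`exists_stage_hom_baseChange_eq_of_algHom`),
transport GENERATION from the geometric generic fibre to every fibre of `𝒜_R` (`generates_fibre_of_generates_fibre_of_injective`: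
closed image of the proper sum maps + going-down along the flat `𝒜_R → Spec R`), specialise at a finite GALOIS level `L / k`
inside `ℂ` under `R` (`exists_algHom_finite_galois_intermediateField`: a closed point has residue field finite over `k`), where
the fibre `𝒜_L` (still of dimension `dim J'`, `dim_fibre_of_isOfRelDim`) is generated by a POINTED morphism from `X_L`, hence is a
quotient of `J(X_L)`, whose dimension is `dim J(X)` by Galois descent (`Jacobian.dim_le_of_generates_baseChange`, over
`exists_jacobian_nonempty_iso_baseChange`).  This is the dimension half of Grothendieck's «formation of the Albanese variety
commutes with base change» in characteristic `0` for `k ⊆ ℂ`. [cite: Badescu2001, Ch. 5 Thm. 5.3]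
[cite: Grothendieck1962FGA6, Thm. 3.3 (iii)] [cite: Serre1958MorphismesUniversels, no. 2 Thm. 2] -/
theorem Jacobian.dim_le_dim_of_baseChange_complex_of_algPoints (hX : IsSmoothProjective d X) (P₀ : AlgPoints X k)
    (𝒥 : Jacobian X) (𝒥' : Jacobian ((bcFunctor k ℂ).obj X)) : 𝒥'.J.dim ≤ 𝒥.J.dim := by
  classical
  haveI : CharZero k := (algebraMap k ℂ).charZero
  haveI := IsSmoothProjective.isProper_holds hX
  haveI := IsSmoothProjective.geometricallyIntegral_holds hX
  have hXℂ : IsSmoothProjective d ((bcFunctor k ℂ).obj X) := hX.baseChange_obj ℂ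
  haveI := IsSmoothProjective.isProper_holds hXℂ
  haveI := IsSmoothProjective.geometricallyIntegral_holds hXℂ
  -- (S1) spread `J' = J(X_ℂ)` to an abelian scheme `𝒜 / T`, `T ⊆ ℂ` of finite type over `k`
  obtain ⟨T, _, _, _, _, ψT, hψT, 𝒜, -, hdim, ⟨e⟩⟩ :=
    AbelianScheme.exists_abelianScheme_relDim_fibre_iso (k := k) 𝒥'.J
  -- the pointed generating morphism `f : X_ℂ → J' ≅ 𝒜_ψ`
  obtain ⟨Q, hQ⟩ := exists_algPoints_baseChange_of_algPoints (K := ℂ) P₀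
  let ψ : (bcFunctor k ℂ).obj X ⟶ 𝒥'.J.X := 𝒥'.abelJacobi Q
  have hgen : Generates ψ := 𝒥'.generates_abelJacobi Q
  haveI : IsMonHom e.inv.hom.hom.hom := e.inv.hom.hom.isMonHom_hom
  let f : (bcFunctor k ℂ).obj X ⟶ (𝒜.fibre ψT.toRingHom).X := ψ ≫ e.inv.hom.hom.hom
  have hf : (bcFunctor k ℂ).map P₀.toUnitHom ≫ f = 1 := by
    simp only [f, ψ, reassoc_of% (map_toUnitHom_comp_abelJacobi_eq_one 𝒥' P₀ Q hQ), MonObj.one_comp]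
  -- (S2) spread `f` to a stage `R`, `T ⊆ R ⊆ ℂ`
  obtain ⟨R, _, _, _, _, φ, hφ, χ, hχinj, hχ, hσ', F, hF, hFP⟩ :=
    AbelianScheme.exists_stage_hom_baseChange_eq_of_algHom ψT 𝒜 X f
  have hFP₀ := hFP P₀.toUnitHom hf
  -- generation over `ℂ` transported to `F_ℂ`
  have hgenℂ : Generates (A := (𝒜.baseChange φ).fibre χ.toRingHom) ((Over.pullback (specMap χ.toRingHom)).map F) := by
    rw [hF, generates_iso_hom_comp_iff]
    have h3 : f ≫ (𝒜.fibreFacIso φ χ.toRingHom ψT.toRingHom hχ).inv.hom.hom.hom =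
        ψ ≫ (e.symm ≪≫ (𝒜.fibreFacIso φ χ.toRingHom ψT.toRingHom hχ).symm).hom.hom.hom.hom := by
      simp only [f, Category.assoc]
      rfl
    rw [h3]
    exact hgen.comp_iso _
  -- (S3)+(S4)+(S5): a finite Galois level `L / k` inside `ℂ` under `R`, and generation at that fibre
  obtain ⟨L, _, _, ⟨φL⟩⟩ :=
    Literature.FieldTheory.Galois.exists_algHom_finite_galois_intermediateField (k := k) (E := ℂ) R
  haveI : IsProper ((Over.pullback (specMap (algebraMap k R))).obj X).hom :=
    inferInstanceAs (IsProper (pullback.snd X.hom (specMap (algebraMap k R))))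
  have hgenL := generates_fibre_of_generates_fibre_of_injective χ.toRingHom hχinj (𝒜.baseChange φ) F hgenℂ φL.toRingHom
  -- the pointed generating morphism `F_L : X_L → 𝒜_L` over `L`
  have hL : φL.toRingHom.comp (algebraMap k R) = algebraMap k L := φL.comp_algebraMap
  let iL := srcFacIso φL.toRingHom (algebraMap k L) hL X
  let FL : (bcFunctor k L).obj X ⟶ ((𝒜.baseChange φ).fibre φL.toRingHom).X :=
    iL.inv ≫ (Over.pullback (specMap φL.toRingHom)).map F
  have hgenFL : Generates FL :=
    (generates_iso_hom_comp_iff (A := (𝒜.baseChange φ).fibre φL.toRingHom)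
      ((Over.pullback (specMap φL.toRingHom)).map F) iL.symm).mpr hgenL
  let ιL : specOver (↥L) (↥L) ⟶ (Over.pullback (specMap φL.toRingHom)).obj
      ((Over.pullback (specMap (algebraMap k R))).obj (𝟙_ (SchemeOver k))) :=
    toUnit _ ≫ Functor.LaxMonoidal.ε (Over.pullback (specMap φL.toRingHom)) ≫
      (Over.pullback (specMap φL.toRingHom)).map (Functor.LaxMonoidal.ε (Over.pullback (specMap (algebraMap k R))))
  let PL : AlgPoints ((bcFunctor k L).obj X) L :=
    ιL ≫ (Over.pullback (specMap φL.toRingHom)).map ((Over.pullback (specMap (algebraMap k R))).map P₀.toUnitHom) ≫ iL.hom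
  have hPL : PL ≫ FL = 1 := by
    simp only [PL, FL, Category.assoc, Iso.hom_inv_id_assoc, ← Functor.map_comp, hFP₀]
    rw [(𝒜.baseChange φ).pullback_map_one φL.toRingHom]
    exact MonObj.comp_one _
  -- conclude: `dim J' = dim 𝒜_L ≤ dim J(X)`
  have hle := Jacobian.dim_le_of_generates_baseChange hX 𝒥 PL FL hPL hgenFL
  have hdimL : ((𝒜.baseChange φ).fibre φL.toRingHom).dim = 𝒥'.J.dim :=
    dim_fibre_of_isOfRelDim (hdim.baseChange (f := φ)) φL.toRingHom
  omega

/-- **`dim J(X_L) = dim J(X)` for a finite Galois `L / k`** (any Jacobian `𝒥L` of `X_L`, any Jacobian `𝒥` of `X`): Galois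
descent of the abstract Jacobian WITH its comparison isomorphism (`exists_jacobian_nonempty_iso_baseChange`), invariance of
`dim` under base change and under isomorphisms. [cite: Milne1986JacobianVarieties, Remark 1.9 and §6 Prop. 6.4] -/
theorem Jacobian.dim_eq_dim_of_isGalois {k : Type u} [Field k] {L : Type u} [Field L] [Algebra k L]
    [FiniteDimensional k L] [IsGalois k L] {d : ℕ} {X : SchemeOver k} (hX : IsSmoothProjective d X)
    (𝒥 : Jacobian X) (𝒥L : Jacobian ((bcFunctor k L).obj X)) : 𝒥L.J.dim = 𝒥.J.dim := by
  obtain ⟨𝒥₀, ⟨e⟩⟩ := Jacobian.exists_jacobian_nonempty_iso_baseChange hX L 𝒥L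
  have hdim : ∀ {K' : Type u} [Field K'] {A A' : AbelianVariety K'} (i : A ≅ A'), A.dim = A'.dim := by
    intro K' _ A A' i
    haveI : IsIso (AbelianVariety.Hom.toSchemeHom i.hom) :=
      ⟨AbelianVariety.Hom.toSchemeHom i.inv,
        by rw [← AbelianVariety.toSchemeHom_comp, i.hom_inv_id]; rfl,
        by rw [← AbelianVariety.toSchemeHom_comp, i.inv_hom_id]; rfl⟩
    exact AbelianVariety.dim_eq_of_isIsogeny (f := i.hom) ⟨inferInstance, inferInstance⟩
  rw [hdim e, AbelianVariety.dim_baseChange, hdim (Jacobian.uniqueUpToIso 𝒥₀ 𝒥)]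

/-- **`dim J(X_ℂ) ≤ dim J(X)`** for every smooth projective geometrically irreducible `X` over a subfield `k ⊆ ℂ`, every
Jacobian `𝒥` of `X` and every Jacobian `𝒥'` of `X_ℂ` — the point-free form: `X` acquires a point over a finite Galois `L₀ / k`
(`IsSmoothProjective.exists_algPoints`), embedded in `ℂ` over `k` (`IsAlgClosed.lift`); the pointed case over `L₀` compares a
Jacobian of `X_{L₀}` (`nonempty_jacobian_of_isSmoothProjective_of_algPoints_of_algebra_complex`) with the transport of `𝒥'` along
`(X_{L₀})_ℂ ≅ X_ℂ` (`bcFunctorTowerIso`, `Jacobian.exists_of_iso`), and `dim J(X_{L₀}) = dim J(X)` (`Jacobian.dim_eq_dim_of_isGalois`).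
[cite: Badescu2001, Ch. 5 Thm. 5.3] [cite: Grothendieck1962FGA6, Thm. 3.3 (iii)] -/
theorem Jacobian.dim_le_dim_of_baseChange_complex (hX : IsSmoothProjective d X) (𝒥 : Jacobian X)
    (𝒥' : Jacobian ((bcFunctor k ℂ).obj X)) :
    𝒥'.J.dim ≤ 𝒥.J.dim := by
  classical
  -- a finite Galois `L₀ / k` over which `X` acquires a point, embedded in `ℂ`
  obtain ⟨L₀, _, _, hfd, hgal, ⟨P⟩⟩ := hX.exists_algPoints
  haveI := hfd
  haveI := hgal
  letI : Algebra L₀ ℂ := ((IsAlgClosed.lift : L₀ →ₐ[k] ℂ) : L₀ →+* ℂ).toAlgebra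
  haveI : IsScalarTower k L₀ ℂ :=
    IsScalarTower.of_algebraMap_eq fun x => ((IsAlgClosed.lift : L₀ →ₐ[k] ℂ).commutes x).symm
  have hXL : IsSmoothProjective d ((bcFunctor k L₀).obj X) := hX.baseChange_obj L₀
  -- Jacobians of `X_{L₀}` and of `(X_{L₀})_ℂ ≅ X_ℂ`
  obtain ⟨𝒥L⟩ := nonempty_jacobian_of_isSmoothProjective_of_algPoints_of_algebra_complex _ hXL
    (Jacobian.pointBaseChange L₀ P)
  obtain ⟨𝒥'', i, -⟩ := 𝒥'.exists_of_iso ((AbelianVariety.bcFunctorTowerIso k L₀ ℂ).app X).symm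
  -- the pointed case over `L₀`
  have h := Jacobian.dim_le_dim_of_baseChange_complex_of_algPoints hXL (Jacobian.pointBaseChange L₀ P) 𝒥L 𝒥''
  have hdim : ∀ {K' : Type} [Field K'] {A A' : AbelianVariety K'} (i : A ≅ A'), A.dim = A'.dim := by
    intro K' _ A A' i
    haveI : IsIso (AbelianVariety.Hom.toSchemeHom i.hom) :=
      ⟨AbelianVariety.Hom.toSchemeHom i.inv,
        by rw [← AbelianVariety.toSchemeHom_comp, i.hom_inv_id]; rfl,
        by rw [← AbelianVariety.toSchemeHom_comp, i.inv_hom_id]; rfl⟩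
    exact AbelianVariety.dim_eq_of_isIsogeny (f := i.hom) ⟨inferInstance, inferInstance⟩
  rw [hdim i, Jacobian.dim_eq_dim_of_isGalois hX 𝒥 𝒥L] at h
  exact h

/-- **`dim J(X_ℂ) = dim J(X)`** (pointed form): the inequality `≤` above and `≥` from the surjective comparison homomorphism
`J(X_ℂ) → J(X) ×_k ℂ` (`Jacobian.exists_hom_baseChange_surjective`, `AbelianVariety.dim_le_of_surjective`, `dim_baseChange`).
[cite: Badescu2001, Ch. 5 Thm. 5.3] [cite: Grothendieck1962FGA6, Thm. 3.3 (iii)] -/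
theorem Jacobian.dim_baseChange_complex_eq_of_algPoints (hX : IsSmoothProjective d X) (P₀ : AlgPoints X k)
    (𝒥 : Jacobian X) (𝒥' : Jacobian ((bcFunctor k ℂ).obj X)) : 𝒥'.J.dim = 𝒥.J.dim := by
  haveI := IsSmoothProjective.isProper_holds hX
  haveI := IsSmoothProjective.geometricallyIntegral_holds hX
  refine le_antisymm (Jacobian.dim_le_dim_of_baseChange_complex_of_algPoints hX P₀ 𝒥 𝒥') ?_
  obtain ⟨u, -, hu⟩ := 𝒥.exists_hom_baseChange_surjective ℂ 𝒥' P₀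
  haveI := hu
  rw [← 𝒥.J.dim_baseChange ℂ]
  exact AbelianVariety.dim_le_of_surjective u

/-- **`dim J(X_ℂ) = dim J(X)`** for every smooth projective geometrically irreducible `X` over a subfield `k ⊆ ℂ` (point-free):
reduce to the pointed case over a finite Galois `L₀ / k` as in `dim_le_dim_of_baseChange_complex`.
[cite: Badescu2001, Ch. 5 Thm. 5.3] [cite: Grothendieck1962FGA6, Thm. 3.3 (iii)] -/
theorem Jacobian.dim_baseChange_complex_eq (hX : IsSmoothProjective d X) (𝒥 : Jacobian X)
    (𝒥' : Jacobian ((bcFunctor k ℂ).obj X)) : 𝒥'.J.dim = 𝒥.J.dim := by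
  classical
  obtain ⟨L₀, _, _, hfd, hgal, ⟨P⟩⟩ := hX.exists_algPoints
  haveI := hfd
  haveI := hgal
  letI : Algebra L₀ ℂ := ((IsAlgClosed.lift : L₀ →ₐ[k] ℂ) : L₀ →+* ℂ).toAlgebra
  haveI : IsScalarTower k L₀ ℂ :=
    IsScalarTower.of_algebraMap_eq fun x => ((IsAlgClosed.lift : L₀ →ₐ[k] ℂ).commutes x).symm
  have hXL : IsSmoothProjective d ((bcFunctor k L₀).obj X) := hX.baseChange_obj L₀
  obtain ⟨𝒥L⟩ := nonempty_jacobian_of_isSmoothProjective_of_algPoints_of_algebra_complex _ hXL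
    (Jacobian.pointBaseChange L₀ P)
  obtain ⟨𝒥'', i, -⟩ := 𝒥'.exists_of_iso ((AbelianVariety.bcFunctorTowerIso k L₀ ℂ).app X).symm
  have h := Jacobian.dim_baseChange_complex_eq_of_algPoints hXL (Jacobian.pointBaseChange L₀ P) 𝒥L 𝒥''
  have hdim : ∀ {K' : Type} [Field K'] {A A' : AbelianVariety K'} (i : A ≅ A'), A.dim = A'.dim := by
    intro K' _ A A' i
    haveI : IsIso (AbelianVariety.Hom.toSchemeHom i.hom) :=
      ⟨AbelianVariety.Hom.toSchemeHom i.inv,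
        by rw [← AbelianVariety.toSchemeHom_comp, i.hom_inv_id]; rfl,
        by rw [← AbelianVariety.toSchemeHom_comp, i.inv_hom_id]; rfl⟩
    exact AbelianVariety.dim_eq_of_isIsogeny (f := i.hom) ⟨inferInstance, inferInstance⟩
  rw [hdim i, Jacobian.dim_eq_dim_of_isGalois hX 𝒥 𝒥L] at h
  exact h

/-- **The III-0 form: `2·dim J(X) = b₁(X_ℂ)` descends from `ℂ` to `k`.**  If the complex Albanese inequality (R-ℂ)
`b₁(X_ℂ) ≤ 2·dim J(X_ℂ)` holds for SOME Jacobian of `X_ℂ` (in the tree for curves and for compact ball quotient surfaces), then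
`b₁(X_ℂ) ≤ 2·dim J(X)` for EVERY Jacobian `𝒥` of `X` over `k` — the hypothesis under which the tree's Albanese criterion makes
`((f^P)_ℂ)^*` an isomorphism on `H¹(−(ℂ); ℚ)` (`AlbaneseRationalCohomology`, `AlbaneseExistenceComplex` §5). [cite: Liu2021, Lemma 2.4 (1)]
[cite: Badescu2001, Ch. 5 Thm. 5.3] -/
theorem Jacobian.finrank_bettiCohomology_le_two_mul_dim_of_baseChange_complex (hX : IsSmoothProjective d X)
    (𝒥 : Jacobian X) (𝒥' : Jacobian ((bcFunctor k ℂ).obj X))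
    (hRC : Module.finrank ℚ (bettiCohomology ((bcFunctor k ℂ).obj X) 1) ≤ 2 * 𝒥'.J.dim) :
    Module.finrank ℚ (bettiCohomology ((bcFunctor k ℂ).obj X) 1) ≤ 2 * 𝒥.J.dim := by
  have h := Jacobian.dim_le_dim_of_baseChange_complex hX 𝒥 𝒥'
  omega

/-! ### The comparison homomorphism `J(X_ℂ) → J(X) ×_k ℂ` is an ISOGENY (appended) -/

/-- **Every comparison homomorphism `u : J(X_ℂ) → J(X) ×_k ℂ` with `[x − y]' ≫ u = [x − y]_ℂ` is an ISOGENY** (pointed `X`):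
it is surjective (`JacobianBaseChangeSurjective`: the base-changed Abel–Jacobi map generates `J(X)_ℂ` and factors through `u`)
between abelian varieties of the SAME dimension (`dim_baseChange_complex_eq_of_algPoints`, `dim_baseChange`), hence finite
(`Generates.isIsogeny_of_comp_eq`).  The isogeny form of «the Albanese variety commutes with base change to `ℂ`»; the
isomorphism form would additionally need the degree to be `1`. [cite: Grothendieck1962FGA6, Thm. 3.3 (iii)]
[cite: Serre1958MorphismesUniversels, no. 2 Thm. 2 (proof)] -/
theorem Jacobian.isIsogeny_of_diff_comp_eq_baseChange_complex (hX : IsSmoothProjective d X) (P₀ : AlgPoints X k)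
    (𝒥 : Jacobian X) (𝒥' : Jacobian ((bcFunctor k ℂ).obj X)) (u : 𝒥'.J ⟶ 𝒥.J.baseChange ℂ)
    (hu : 𝒥'.diff ≫ u.hom.hom.hom =
      (Functor.Monoidal.μIso (bcFunctor k ℂ) X X).hom ≫ (bcFunctor k ℂ).map 𝒥.diff) :
    AbelianVariety.IsIsogeny u := by
  haveI := IsSmoothProjective.isProper_holds hX
  haveI := IsSmoothProjective.geometricallyIntegral_holds hX
  -- the base-changed Abel–Jacobi map generates `J(X)_ℂ` and factors through `u`
  have hgen : Generates (A := 𝒥.J.baseChange ℂ) ((bcFunctor k ℂ).map (𝒥.abelJacobi P₀)) :=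
    (𝒥.generates_abelJacobi P₀).baseChange ℂ
  have hfac : (lift (𝟙 _) ((bcFunctor k ℂ).map (toSpecOver X ≫ P₀)) ≫ 𝒥'.diff) ≫ u.hom.hom.hom =
      (bcFunctor k ℂ).map (𝒥.abelJacobi P₀) := by
    rw [Category.assoc, hu, ← Category.assoc, Functor.Monoidal.μIso_hom, ← (bcFunctor k ℂ).map_id,
      Functor.Monoidal.lift_μ, ← Functor.map_comp]
    rfl
  refine hgen.isIsogeny_of_comp_eq u hfac ?_
  rw [AbelianVariety.dim_baseChange]
  exact Jacobian.dim_le_dim_of_baseChange_complex_of_algPoints hX P₀ 𝒥 𝒥'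

/-- **`J(X_ℂ)` is ISOGENOUS to `J(X) ×_k ℂ`** for `X` smooth projective geometrically irreducible over `k ⊆ ℂ` with a rational
point: the universal property of `J(X_ℂ)` gives a comparison homomorphism with `[x − y]' ≫ u = [x − y]_ℂ`
(`Jacobian.exists_hom_baseChange_surjective`), which is an isogeny by `isIsogeny_of_diff_comp_eq_baseChange_complex`.
[cite: Grothendieck1962FGA6, Thm. 3.3 (iii)] [cite: Serre1958MorphismesUniversels, no. 2 Thm. 2] -/
theorem Jacobian.exists_isIsogeny_baseChange_complex (hX : IsSmoothProjective d X) (P₀ : AlgPoints X k)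
    (𝒥 : Jacobian X) (𝒥' : Jacobian ((bcFunctor k ℂ).obj X)) :
    ∃ u : 𝒥'.J ⟶ 𝒥.J.baseChange ℂ,
      𝒥'.diff ≫ u.hom.hom.hom = (Functor.Monoidal.μIso (bcFunctor k ℂ) X X).hom ≫ (bcFunctor k ℂ).map 𝒥.diff ∧
        AbelianVariety.IsIsogeny u := by
  haveI := IsSmoothProjective.isProper_holds hX
  haveI := IsSmoothProjective.geometricallyIntegral_holds hX
  obtain ⟨u, hu, -⟩ := 𝒥.exists_hom_baseChange_surjective ℂ 𝒥' P₀
  exact ⟨u, hu, Jacobian.isIsogeny_of_diff_comp_eq_baseChange_complex hX P₀ 𝒥 𝒥' u hu⟩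

end Main

end Literature.AlgebraicGeometry.Motives

end
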